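import Mathlib.Analysis.Calculus.MeanValue
import Mathlib.Topology.Instances.Matrix
import Literature.Analysis.FluidPDE.HyperbolicConeEnergy
import Literature.Barriers.AtomisticToContinuum.NoBVEstimatesMultiDFinitePropagation
import HarnessLib

/-!
# Finite speed of propagation, symmetrizable case: the energy identity of the perturbation

Third file of the discharge of `Rauch1986_finitePropagationSpeed_symmetrizable`
(`NoBVEstimatesMultiDFinitePropagation.lean`). For a classical solution `u` of the quasilinear
system (1) `A₀(u)∂ₜu + Σ Aⱼ(u)∂ⱼu + B(u) = 0` and a symmetrizer `Sym`, the perturbation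
`w = u - ū` of the constant state has energy density `e = ⟨w, Sym(u)A₀(u)w⟩` and fluxes
`fⱼ = ⟨w, Sym(u)Aⱼ(u)w⟩` (`energyDensity`, `energyFlux`), and this file proves the pointwise
inputs of the cone lemma `Literature.Analysis.FluidPDE.coneEnergy_eq_zero`:

* `IsClassicalSolution.bulk_le` — Racke's identity [Racke2015, proof of Thm 3.1, (3.9)]
  `∂ₜ⟨Ã⁰w,w⟩ + Σ∂ⱼ⟨Ãʲw,w⟩ = 2⟨w, Ã⁰∂ₜw + ΣÃʲ∂ⱼw⟩ + ⟨w, (∂ₜÃ⁰ + Σ∂ⱼÃʲ)w⟩` (symmetry of the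
  `Ãʲ = Sym Aⱼ`), combined with the equation in the form
  `Sym(u)A₀(u)∂ₜw + Σ Sym(u)Aⱼ(u)∂ⱼw = -Sym(u)B(u)` [Rendall2008, §8.3 (8.29)] and the bounds
  `‖Sym(u)B(u)‖ ≤ L‖u - ū‖` (`B(ū) = 0`, mean value inequality), `|∂Ãᵢⱼ| ≤ Ĉ`, giving
  `∂ₜe + Σⱼ∂ⱼfⱼ ≤ (2kL + (d+1)k²Ĉ)‖w‖²`;
* `energyFlux_cone_bound` — the cone condition `|Σ νⱼfⱼ| ≤ dα‖w‖²` for `‖ν‖ ≤ 1`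
  [Racke2015, (3.11)];
* the uniform constants on a compact set of states: `λ‖ξ‖² ≤ ⟨ξ, Ã⁰(v)ξ⟩` from positive
  definiteness (`exists_pos_mul_norm_sq_le_dotProduct_mulVec`, Racke's `a₀`), `|⟨ξ, Ãʲ(v)ξ⟩| ≤
  α‖ξ‖²` (`exists_abs_dotProduct_mulVec_le`, Racke's `a₁`), the Lipschitz bound
  (`exists_norm_le_mul_norm_sub`), and the derivative bound on compact parts of the slab
  (`exists_norm_fderiv_le_of_contDiffOn_slab`);
* the calculus lemma `hasFDerivAt_dotProduct_mulVec` (derivative of `q ↦ ⟨w(q), A(q)w(q)⟩`) and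
  the relations between `timeDerivWithin` / spatial `fderiv` of the `IsClassicalSolution` API and
  the Fréchet derivative of the space–time field at interior times.

Norms on `ℝᵏ = Fin k → ℝ` are the sup norms of Mathlib's Pi type; all constants are explicit.

## References

* [Racke2015] R. Racke, *Lectures on Nonlinear Evolution Equations*, 2nd ed., Ch. 3, proof of
  Thm 3.1 ((3.7), (3.9)–(3.11)).
* [Rendall2008] A. D. Rendall, *Partial Differential Equations in General Relativity*, §8.3,
  (8.28)–(8.29).
* [Rauch1986] J. Rauch, Comm. Math. Phys. 106 (1986), Proof of Theorem p. 482.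
-/

noncomputable section

open Set Filter Metric Matrix
open scoped Topology ContDiff

namespace Literature.Barriers.AtomisticToContinuum

open Literature.Analysis.FluidPDE

namespace QuasilinearSystem

variable {d k : ℕ}

/-! ### Linear algebra in the sup norm of `ℝᵏ` -/

/-- `|⟨ξ, z⟩| ≤ k‖ξ‖‖z‖` for the sup norms. [folklore] -/
theorem abs_dotProduct_le (ξ z : Fin k → ℝ) : |ξ ⬝ᵥ z| ≤ k * (‖ξ‖ * ‖z‖) := by
  calc |ξ ⬝ᵥ z| = |∑ i, ξ i * z i| := rfl
    _ ≤ ∑ i, |ξ i * z i| := Finset.abs_sum_le_sum_abs _ _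
    _ ≤ ∑ _i : Fin k, ‖ξ‖ * ‖z‖ := Finset.sum_le_sum fun i _ => by
        rw [abs_mul]
        exact mul_le_mul (by simpa [Real.norm_eq_abs] using norm_le_pi_norm ξ i)
          (by simpa [Real.norm_eq_abs] using norm_le_pi_norm z i) (abs_nonneg _) (norm_nonneg _)
    _ = k * (‖ξ‖ * ‖z‖) := by simp

/-- `|⟨ξ, Mζ⟩| ≤ (Σᵢⱼ|Mᵢⱼ|)‖ξ‖‖ζ‖` for the sup norms. [folklore] -/
theorem abs_dotProduct_mulVec_le (M : Matrix (Fin k) (Fin k) ℝ) (ξ ζ : Fin k → ℝ) :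
    |ξ ⬝ᵥ (M *ᵥ ζ)| ≤ (∑ i, ∑ j, |M i j|) * (‖ξ‖ * ‖ζ‖) := by
  have h1 : ∀ i, |(M *ᵥ ζ) i| ≤ (∑ j, |M i j|) * ‖ζ‖ := fun i => by
    simp only [mulVec, dotProduct]
    refine (Finset.abs_sum_le_sum_abs _ _).trans ?_
    rw [Finset.sum_mul]
    exact Finset.sum_le_sum fun j _ => by
      rw [abs_mul]
      exact mul_le_mul_of_nonneg_left (by simpa [Real.norm_eq_abs] using norm_le_pi_norm ζ j)
        (abs_nonneg _)
  calc |ξ ⬝ᵥ (M *ᵥ ζ)| = |∑ i, ξ i * (M *ᵥ ζ) i| := rfl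
    _ ≤ ∑ i, |ξ i * (M *ᵥ ζ) i| := Finset.abs_sum_le_sum_abs _ _
    _ ≤ ∑ i, ‖ξ‖ * ((∑ j, |M i j|) * ‖ζ‖) := Finset.sum_le_sum fun i _ => by
        rw [abs_mul]
        exact mul_le_mul (by simpa [Real.norm_eq_abs] using norm_le_pi_norm ξ i) (h1 i)
          (abs_nonneg _) (norm_nonneg _)
    _ = (∑ i, ∑ j, |M i j|) * (‖ξ‖ * ‖ζ‖) := by
        rw [Finset.sum_mul]
        exact Finset.sum_congr rfl fun i _ => by ring

/-- For a symmetric matrix, `⟨x, Ay⟩ = ⟨y, Ax⟩`. [folklore] -/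
theorem dotProduct_mulVec_comm_of_transpose {A : Matrix (Fin k) (Fin k) ℝ} (hA : Aᵀ = A)
    (x y : Fin k → ℝ) : x ⬝ᵥ (A *ᵥ y) = y ⬝ᵥ (A *ᵥ x) := by
  rw [dotProduct_mulVec, ← mulVec_transpose, hA, dotProduct_comm]

/-- Homogeneity of the quadratic form: `⟨aξ, M(aξ)⟩ = a²⟨ξ, Mξ⟩`. [folklore] -/
theorem smul_dotProduct_mulVec_smul (M : Matrix (Fin k) (Fin k) ℝ) (a : ℝ) (ξ : Fin k → ℝ) :
    (a • ξ) ⬝ᵥ (M *ᵥ (a • ξ)) = a ^ 2 * (ξ ⬝ᵥ (M *ᵥ ξ)) := by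
  simp only [mulVec_smul, dotProduct_smul, smul_dotProduct, smul_eq_mul]
  ring

/-- A positive definite real matrix is symmetric. [folklore] -/
theorem transpose_eq_of_posDef {A : Matrix (Fin k) (Fin k) ℝ} (hA : A.PosDef) : Aᵀ = A := by
  have h := hA.isHermitian
  rwa [IsHermitian, conjTranspose_eq_transpose_of_trivial] at h

/-! ### Uniform constants on a compact set of states -/

/-- **Uniform positivity** (Racke's `a₀` [Racke2015, (3.7)]): a continuous family of positive
definite matrices over a compact set is uniformly positive definite, `λ‖ξ‖² ≤ ⟨ξ, F(v)ξ⟩`.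
[folklore] -/
theorem exists_pos_mul_norm_sq_le_dotProduct_mulVec {K₀ : Set (Fin k → ℝ)} (hK : IsCompact K₀)
    {F : (Fin k → ℝ) → Matrix (Fin k) (Fin k) ℝ} (hF : Continuous F)
    (hpos : ∀ v ∈ K₀, (F v).PosDef) :
    ∃ lam : ℝ, 0 < lam ∧ ∀ v ∈ K₀, ∀ ξ : Fin k → ℝ, lam * ‖ξ‖ ^ 2 ≤ ξ ⬝ᵥ (F v *ᵥ ξ) := by
  have hnorm : ∀ {ξ : Fin k → ℝ}, ξ ≠ 0 → (‖ξ‖⁻¹ • ξ) ∈ sphere (0 : Fin k → ℝ) 1 := fun hξ => by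
    rw [mem_sphere_zero_iff_norm, norm_smul, norm_inv, norm_norm,
      inv_mul_cancel₀ (norm_ne_zero_iff.2 hξ)]
  rcases (K₀ ×ˢ sphere (0 : Fin k → ℝ) 1).eq_empty_or_nonempty with hempty | hne
  · refine ⟨1, one_pos, fun v hv ξ => ?_⟩
    by_cases hξ : ξ = 0
    · simp [hξ]
    · have hmem : (v, ‖ξ‖⁻¹ • ξ) ∈ K₀ ×ˢ sphere (0 : Fin k → ℝ) 1 := mk_mem_prod hv (hnorm hξ)
      rw [hempty] at hmem
      exact absurd hmem (notMem_empty _)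
  · set G : (Fin k → ℝ) × (Fin k → ℝ) → ℝ := fun z => z.2 ⬝ᵥ (F z.1 *ᵥ z.2) with hG
    have hGc : Continuous G :=
      continuous_snd.dotProduct ((hF.comp continuous_fst).matrix_mulVec continuous_snd)
    obtain ⟨z₀, hz₀, hmin⟩ :=
      (hK.prod (isCompact_sphere _ _)).exists_isMinOn hne hGc.continuousOn
    have hz₀2 : z₀.2 ≠ 0 := by
      have : ‖z₀.2‖ = 1 := mem_sphere_zero_iff_norm.1 hz₀.2
      intro h0
      rw [h0, norm_zero] at this
      exact zero_ne_one this
    have hlam : 0 < G z₀ := by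
      have := (hpos z₀.1 hz₀.1).dotProduct_mulVec_pos hz₀2
      simpa [hG] using this
    refine ⟨G z₀, hlam, fun v hv ξ => ?_⟩
    by_cases hξ : ξ = 0
    · simp [hξ]
    · have hn : 0 < ‖ξ‖ := norm_pos_iff.2 hξ
      have h1 : G z₀ ≤ G (v, ‖ξ‖⁻¹ • ξ) := isMinOn_iff.1 hmin _ (mk_mem_prod hv (hnorm hξ))
      have h2 : G (v, ‖ξ‖⁻¹ • ξ) = ‖ξ‖⁻¹ ^ 2 * (ξ ⬝ᵥ (F v *ᵥ ξ)) := by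
        simp only [hG]
        exact smul_dotProduct_mulVec_smul _ _ _
      rw [h2] at h1
      calc G z₀ * ‖ξ‖ ^ 2 ≤ ‖ξ‖⁻¹ ^ 2 * (ξ ⬝ᵥ (F v *ᵥ ξ)) * ‖ξ‖ ^ 2 :=
            mul_le_mul_of_nonneg_right h1 (sq_nonneg _)
        _ = ξ ⬝ᵥ (F v *ᵥ ξ) := by field_simp

/-- **Uniform bound of the flux forms** (Racke's `a₁` [Racke2015, (3.7)]):
`|⟨ξ, F_l(v)ξ⟩| ≤ α‖ξ‖²` uniformly over a compact set of states and finitely many `l`.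
[folklore] -/
theorem exists_abs_dotProduct_mulVec_le {K₀ : Set (Fin k → ℝ)} (hK : IsCompact K₀)
    {F : Fin d → (Fin k → ℝ) → Matrix (Fin k) (Fin k) ℝ} (hF : ∀ l, Continuous (F l)) :
    ∃ α : ℝ, 0 ≤ α ∧ ∀ l, ∀ v ∈ K₀, ∀ ξ : Fin k → ℝ, |ξ ⬝ᵥ (F l v *ᵥ ξ)| ≤ α * ‖ξ‖ ^ 2 := by
  have h : ∀ l, ∃ C : ℝ, ∀ v ∈ K₀, ∑ i, ∑ j, |F l v i j| ≤ C := fun l => by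
    have hc : Continuous fun v => ∑ i, ∑ j, |F l v i j| :=
      continuous_finsetSum _ fun i _ => continuous_finsetSum _ fun j _ =>
        ((hF l).matrix_elem i j).abs
    obtain ⟨C, hC⟩ := hK.exists_bound_of_continuousOn hc.continuousOn
    exact ⟨C, fun v hv => (le_abs_self _).trans ((Real.norm_eq_abs _).symm.le.trans (hC v hv))⟩
  choose C hC using h
  refine ⟨∑ l, |C l|, Finset.sum_nonneg fun l _ => abs_nonneg _, fun l v hv ξ => ?_⟩
  calc |ξ ⬝ᵥ (F l v *ᵥ ξ)| ≤ (∑ i, ∑ j, |F l v i j|) * (‖ξ‖ * ‖ξ‖) :=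
        abs_dotProduct_mulVec_le _ _ _
    _ ≤ |C l| * ‖ξ‖ ^ 2 := by
        rw [← pow_two]
        exact mul_le_mul_of_nonneg_right ((hC l v hv).trans (le_abs_self _)) (sq_nonneg _)
    _ ≤ (∑ l', |C l'|) * ‖ξ‖ ^ 2 :=
        mul_le_mul_of_nonneg_right
          (Finset.single_le_sum (fun l' _ => abs_nonneg (C l')) (Finset.mem_univ l)) (sq_nonneg _)

/-- **Lipschitz bound at a zero** (the "sharp mean value theorem" step of
[Rendall2008, §8.3 (8.29)]): a `C¹` map vanishing at `ū` satisfies `‖β(v)‖ ≤ L‖v - ū‖` on a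
closed ball around `ū`. [folklore] -/
theorem exists_norm_le_mul_norm_sub {β : (Fin k → ℝ) → Fin k → ℝ} (hβ : ContDiff ℝ 1 β)
    {ubar : Fin k → ℝ} (h0 : β ubar = 0) {r : ℝ} (hr : 0 ≤ r) :
    ∃ L : ℝ, 0 ≤ L ∧ ∀ v ∈ closedBall ubar r, ‖β v‖ ≤ L * ‖v - ubar‖ := by
  obtain ⟨L, hL⟩ := (isCompact_closedBall ubar r).exists_bound_of_continuousOn
    (hβ.continuous_fderiv one_ne_zero).continuousOn
  refine ⟨max L 0, le_max_right _ _, fun v hv => ?_⟩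
  have key := (convex_closedBall ubar r).norm_image_sub_le_of_norm_fderiv_le (𝕜 := ℝ) (f := β)
    (fun x _ => hβ.differentiable one_ne_zero x) (fun x hx => (hL x hx).trans (le_max_left L 0))
    (mem_closedBall_self hr) hv
  simpa [h0] using key

/-- **Derivative bound on compact parts of the slab**: a map which is `C¹` on
`[a, b] × ℝᵈ` (one-sided at the ends) has `‖DF‖ ≤ C` on any compact `K ⊆ [a, b] × ℝᵈ`, at the
points of `K` with interior time. [folklore] -/
theorem exists_norm_fderiv_le_of_contDiffOn_slab {G : Type*} [NormedAddCommGroup G]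
    [NormedSpace ℝ G] {F : ℝ × Space d → G} {a b : ℝ} (hab : a < b)
    (hF : ContDiffOn ℝ 1 F (Icc a b ×ˢ univ)) {K : Set (ℝ × Space d)} (hK : IsCompact K)
    (hKs : K ⊆ Icc a b ×ˢ univ) :
    ∃ C : ℝ, 0 ≤ C ∧ ∀ p ∈ K, p.1 ∈ Ioo a b → ‖fderiv ℝ F p‖ ≤ C := by
  have hU : UniqueDiffOn ℝ (Icc a b ×ˢ (univ : Set (Space d))) :=
    (uniqueDiffOn_Icc hab).prod uniqueDiffOn_univ
  have hcont : ContinuousOn (fderivWithin ℝ F (Icc a b ×ˢ univ)) (Icc a b ×ˢ univ) :=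
    hF.continuousOn_fderivWithin hU le_rfl
  obtain ⟨C, hC⟩ := hK.exists_bound_of_continuousOn (hcont.mono hKs)
  refine ⟨max C 0, le_max_right _ _, fun p hp hp1 => ?_⟩
  have hn : Icc a b ×ˢ (univ : Set (Space d)) ∈ 𝓝 p :=
    prod_mem_nhds (Icc_mem_nhds hp1.1 hp1.2) univ_mem
  rw [← fderivWithin_of_mem_nhds hn]
  exact (hC p hp).trans (le_max_left _ _)

/-! ### The derivative of a quadratic form along a map -/

/-- **Derivative of `q ↦ ⟨w(q), A(q)w(q)⟩`** from the derivatives of the components `wᵢ` and of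
the entries `Aᵢⱼ` (product rule, term by term). [folklore] -/
theorem hasFDerivAt_dotProduct_mulVec {P : Type*} [NormedAddCommGroup P] [NormedSpace ℝ P]
    {w : P → Fin k → ℝ} {A : P → Matrix (Fin k) (Fin k) ℝ} {p : P}
    {w' : Fin k → P →L[ℝ] ℝ} {A' : Fin k → Fin k → P →L[ℝ] ℝ}
    (hw : ∀ i, HasFDerivAt (fun q => w q i) (w' i) p)
    (hA : ∀ i j, HasFDerivAt (fun q => A q i j) (A' i j) p) :
    HasFDerivAt (fun q => w q ⬝ᵥ (A q *ᵥ w q))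
      (∑ i, ∑ j, ((w p i * A p i j) • w' j + w p j • (w p i • A' i j + A p i j • w' i))) p := by
  have heq : (fun q => w q ⬝ᵥ (A q *ᵥ w q)) = fun q => ∑ i, ∑ j, w q i * A q i j * w q j := by
    funext q
    simp only [dotProduct, mulVec, Finset.mul_sum, mul_assoc]
  rw [heq]
  exact HasFDerivAt.fun_sum fun i _ => HasFDerivAt.fun_sum fun j _ =>
    ((hw i).mul (hA i j)).mul (hw j)

/-- The applied form of `hasFDerivAt_dotProduct_mulVec`:
`D⟨w, Aw⟩(p)v = ⟨Dw v, Aw⟩ + ⟨w, (DA v)w⟩ + ⟨w, A Dw v⟩`. [folklore] -/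
theorem fderiv_dotProduct_mulVec_apply {P : Type*} [NormedAddCommGroup P] [NormedSpace ℝ P]
    {w : P → Fin k → ℝ} {A : P → Matrix (Fin k) (Fin k) ℝ} {p : P}
    (hw : DifferentiableAt ℝ w p) (hA : ∀ i j, DifferentiableAt ℝ (fun q => A q i j) p) (v : P) :
    fderiv ℝ (fun q => w q ⬝ᵥ (A q *ᵥ w q)) p v =
      fderiv ℝ w p v ⬝ᵥ (A p *ᵥ w p) +
        w p ⬝ᵥ (Matrix.of (fun i j => fderiv ℝ (fun q => A q i j) p v) *ᵥ w p) +
          w p ⬝ᵥ (A p *ᵥ fderiv ℝ w p v) := by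
  have hw' : ∀ i, HasFDerivAt (fun q => w q i) ((ContinuousLinearMap.proj i).comp (fderiv ℝ w p)) p :=
    fun i => hasFDerivAt_pi'.1 hw.hasFDerivAt i
  rw [(hasFDerivAt_dotProduct_mulVec hw' fun i j => (hA i j).hasFDerivAt).fderiv]
  simp only [_root_.sum_apply, _root_.add_apply, _root_.smul_apply, ContinuousLinearMap.comp_apply,
    ContinuousLinearMap.proj_apply, smul_eq_mul]
  simp only [dotProduct, mulVec, Matrix.of_apply, Finset.mul_sum, ← Finset.sum_add_distrib]
  exact Finset.sum_congr rfl fun i _ => Finset.sum_congr rfl fun j _ => by ring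

/-! ### Smoothness of the symmetrised coefficients -/

/-- The entries of `Sym·A₀` are smooth. [folklore] -/
theorem contDiff_symA0_apply (S : QuasilinearSystem d k)
    {Sym : (Fin k → ℝ) → Matrix (Fin k) (Fin k) ℝ} (hSym : ∀ i i', ContDiff ℝ ∞ fun u => Sym u i i')
    (i j : Fin k) : ContDiff ℝ ∞ fun v => S.symA0 Sym v i j := by
  simp only [symA0_apply, Matrix.mul_apply]
  exact ContDiff.sum fun l _ => (hSym i l).mul (S.contDiff_A0 l j)

/-- The entries of `Sym·Aⱼ` are smooth. [folklore] -/
theorem contDiff_symA_apply (S : QuasilinearSystem d k)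
    {Sym : (Fin k → ℝ) → Matrix (Fin k) (Fin k) ℝ} (hSym : ∀ i i', ContDiff ℝ ∞ fun u => Sym u i i')
    (l : Fin d) (i j : Fin k) : ContDiff ℝ ∞ fun v => S.symA Sym l v i j := by
  simp only [symA_apply, Matrix.mul_apply]
  exact ContDiff.sum fun l' _ => (hSym i l').mul (S.contDiff_A l l' j)

/-- `Sym·A₀` is continuous (matrix-valued). [folklore] -/
theorem continuous_symA0 (S : QuasilinearSystem d k)
    {Sym : (Fin k → ℝ) → Matrix (Fin k) (Fin k) ℝ} (hSym : ∀ i i', ContDiff ℝ ∞ fun u => Sym u i i') :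
    Continuous (S.symA0 Sym) :=
  continuous_matrix fun i j => (S.contDiff_symA0_apply hSym i j).continuous

/-- `Sym·Aⱼ` is continuous (matrix-valued). [folklore] -/
theorem continuous_symA (S : QuasilinearSystem d k)
    {Sym : (Fin k → ℝ) → Matrix (Fin k) (Fin k) ℝ} (hSym : ∀ i i', ContDiff ℝ ∞ fun u => Sym u i i')
    (l : Fin d) : Continuous (S.symA Sym l) :=
  continuous_matrix fun i j => (S.contDiff_symA_apply hSym l i j).continuous

/-- `v ↦ Sym(v)B(v)` is smooth. [folklore] -/
theorem contDiff_sym_mulVec_B (S : QuasilinearSystem d k)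
    {Sym : (Fin k → ℝ) → Matrix (Fin k) (Fin k) ℝ} (hSym : ∀ i i', ContDiff ℝ ∞ fun u => Sym u i i') :
    ContDiff ℝ ∞ fun v => Sym v *ᵥ S.B v := by
  refine contDiff_pi.2 fun i => ?_
  simp only [mulVec, dotProduct]
  exact ContDiff.sum fun j _ => (hSym i j).mul (contDiff_pi.1 S.contDiff_B j)

/-! ### Classical solutions at interior times -/

section Solution

variable {S : QuasilinearSystem d k} {T : ℝ} {u : ℝ → Space d → Fin k → ℝ}

/-- At interior times a classical solution is (jointly) differentiable. [folklore] -/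
theorem IsClassicalSolution.differentiableAt_uncurry (hu : S.IsClassicalSolution T u)
    {p : ℝ × Space d} (hp : p.1 ∈ Ioo 0 T) : DifferentiableAt ℝ (Function.uncurry u) p := by
  have hmem : p ∈ Icc 0 T ×ˢ (univ : Set (Space d)) := ⟨Ioo_subset_Icc_self hp, mem_univ _⟩
  have hn : Icc 0 T ×ˢ (univ : Set (Space d)) ∈ 𝓝 p :=
    prod_mem_nhds (Icc_mem_nhds hp.1 hp.2) univ_mem
  exact (hu.contDiffOn.differentiableOn one_ne_zero p hmem).differentiableAt hn

/-- At interior times the one-sided time derivative of the `IsClassicalSolution` API is the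
Fréchet derivative of the space–time field in the direction `(1, 0)`. [folklore] -/
theorem IsClassicalSolution.timeDerivWithin_eq_fderiv (hu : S.IsClassicalSolution T u) {t : ℝ}
    (ht : t ∈ Ioo 0 T) (x : Space d) :
    timeDerivWithin (Icc 0 T) u t x = fderiv ℝ (Function.uncurry u) (t, x) (1, 0) := by
  have hd := hu.differentiableAt_uncurry (p := (t, x)) ht
  rw [timeDerivWithin_apply, derivWithin_of_mem_nhds (Icc_mem_nhds ht.1 ht.2)]
  have h1 : HasDerivAt (fun s : ℝ => ((s, x) : ℝ × Space d)) (1, 0) t :=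
    (hasDerivAt_id t).prodMk (hasDerivAt_const t x)
  exact (hd.hasFDerivAt.comp_hasDerivAt t h1).deriv

/-- At interior times the spatial derivative of the slice `u t` is the Fréchet derivative of the
space–time field in the direction `(0, v)`. [folklore] -/
theorem IsClassicalSolution.fderiv_slice_eq_fderiv (hu : S.IsClassicalSolution T u) {t : ℝ}
    (ht : t ∈ Ioo 0 T) (x v : Space d) :
    fderiv ℝ (u t) x v = fderiv ℝ (Function.uncurry u) (t, x) (0, v) :=
  fderiv_slab_slice_apply (hu.differentiableAt_uncurry (p := (t, x)) ht) v

/-- **The equation at interior times, in terms of the space–time derivative**: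
`A₀(u)Du(1,0) + Σⱼ Aⱼ(u)Du(0,eⱼ) = -B(u)`. [cite: Rauch1986, (1) p. 481] -/
theorem IsClassicalSolution.eqn_fderiv (hu : S.IsClassicalSolution T u) {t : ℝ} (ht : t ∈ Ioo 0 T)
    (x : Space d) :
    S.A0 (u t x) *ᵥ fderiv ℝ (Function.uncurry u) (t, x) (1, 0) +
        ∑ j, S.A j (u t x) *ᵥ fderiv ℝ (Function.uncurry u) (t, x) (0, EuclideanSpace.single j 1) =
      -S.B (u t x) := by
  have h := hu.eqn t (Ioo_subset_Icc_self ht) x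
  rw [hu.timeDerivWithin_eq_fderiv ht x] at h
  simp_rw [hu.fderiv_slice_eq_fderiv ht x] at h
  exact eq_neg_of_add_eq_zero_left h

/-- **The symmetrised equation paired with the perturbation** [Rendall2008, §8.3 (8.29)]:
`⟨w, Ã₀Du(1,0)⟩ + Σⱼ ⟨w, ÃⱼDu(0,eⱼ)⟩ = -⟨w, Sym(u)B(u)⟩`, `w = u - ū`.
[cite: Rendall2008, §8.3 (8.29)] -/
theorem IsClassicalSolution.dotProduct_sym_eqn (hu : S.IsClassicalSolution T u)
    (Sym : (Fin k → ℝ) → Matrix (Fin k) (Fin k) ℝ) (w : Fin k → ℝ) {t : ℝ} (ht : t ∈ Ioo 0 T)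
    (x : Space d) :
    w ⬝ᵥ (S.symA0 Sym (u t x) *ᵥ fderiv ℝ (Function.uncurry u) (t, x) (1, 0)) +
        ∑ j, w ⬝ᵥ (S.symA Sym j (u t x) *ᵥ
          fderiv ℝ (Function.uncurry u) (t, x) (0, EuclideanSpace.single j 1)) =
      -(w ⬝ᵥ (Sym (u t x) *ᵥ S.B (u t x))) := by
  have h := congrArg (fun z => w ⬝ᵥ (Sym (u t x) *ᵥ z)) (hu.eqn_fderiv ht x)
  simp only [mulVec_add, mulVec_sum, mulVec_mulVec, mulVec_neg, dotProduct_add, dotProduct_sum,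
    dotProduct_neg] at h
  simpa only [symA0_apply, symA_apply] using h

end Solution

/-! ### The bulk inequality and the cone condition -/

section Bulk

variable {S : QuasilinearSystem d k} {T : ℝ} {u : ℝ → Space d → Fin k → ℝ}
  {Sym : (Fin k → ℝ) → Matrix (Fin k) (Fin k) ℝ} {ubar : Fin k → ℝ} {K₀ : Set (Fin k → ℝ)}

/-- **The bulk inequality** `∂ₜe + Σⱼ∂ⱼfⱼ ≤ (2kL + (d+1)k²Ĉ)‖u - ū‖²` at an interior point
where `u(t, x)` lies in the set `K₀` of states on which the symmetrised coefficients are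
symmetric and `‖Sym(v)B(v)‖ ≤ L‖v - ū‖`, and where the entries of `Ã₀(u(·))`, `Ãⱼ(u(·))` have
derivatives of norm `≤ Ĉ`: Racke's identity
`∂ₜ⟨Ã⁰w,w⟩ + Σ∂ⱼ⟨Ãʲw,w⟩ = ⟨(∂ₜÃ⁰ + Σ∂ⱼÃʲ)w, w⟩ - 2⟨w, Sym B(u)⟩` [Racke2015, proof of Thm 3.1,
(3.9)] for the system [Rendall2008, (8.29)] satisfied by `w = u - ū`, followed by the entrywise
bounds in the sup norm. [cite: Racke2015, Ch. 3 Thm 3.1] -/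
theorem IsClassicalSolution.bulk_le (hu : S.IsClassicalSolution T u)
    (hSym : ∀ i i', ContDiff ℝ ∞ fun v => Sym v i i') {L Ĉ : ℝ}
    (hsymm0 : ∀ v ∈ K₀, (S.symA0 Sym v)ᵀ = S.symA0 Sym v)
    (hsymm : ∀ v ∈ K₀, ∀ j, (S.symA Sym j v)ᵀ = S.symA Sym j v)
    (hL : ∀ v ∈ K₀, ‖Sym v *ᵥ S.B v‖ ≤ L * ‖v - ubar‖)
    {t : ℝ} (ht : t ∈ Ioo 0 T) {x : Space d} (hK : u t x ∈ K₀)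
    (hĈ0 : ∀ i j, ‖fderiv ℝ (fun q => S.symA0 Sym (Function.uncurry u q) i j) (t, x)‖ ≤ Ĉ)
    (hĈ : ∀ l i j, ‖fderiv ℝ (fun q => S.symA Sym l (Function.uncurry u q) i j) (t, x)‖ ≤ Ĉ) :
    fderiv ℝ (S.energyDensity Sym ubar (Function.uncurry u)) (t, x) (1, 0) +
        ∑ j, fderiv ℝ (S.energyFlux Sym ubar (Function.uncurry u) j) (t, x)
          (0, EuclideanSpace.single j 1) ≤
      (2 * k * L + (d + 1) * k ^ 2 * Ĉ) * ‖u t x - ubar‖ ^ 2 := by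
  set û : ℝ × Space d → Fin k → ℝ := Function.uncurry u with hû
  set p : ℝ × Space d := (t, x) with hp
  have hup : û p = u t x := rfl
  set w : Fin k → ℝ := u t x - ubar with hw
  have hdiff : DifferentiableAt ℝ û p := hu.differentiableAt_uncurry (p := p) ht
  have hdiffw : DifferentiableAt ℝ (fun q => û q - ubar) p := hdiff.sub_const ubar
  have hfdw : ∀ v, fderiv ℝ (fun q => û q - ubar) p v = fderiv ℝ û p v := fun v => by
    rw [fderiv_sub_const]
  -- differentiability of the entries of the symmetrised coefficients along `u`
  have hA0d : ∀ i j, DifferentiableAt ℝ (fun q => S.symA0 Sym (û q) i j) p := fun i j =>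
    (((S.contDiff_symA0_apply hSym i j).differentiable (by simp)).differentiableAt).comp p hdiff
  have hAd : ∀ l i j, DifferentiableAt ℝ (fun q => S.symA Sym l (û q) i j) p := fun l i j =>
    (((S.contDiff_symA_apply hSym l i j).differentiable (by simp)).differentiableAt).comp p hdiff
  -- the derivative matrices `∂Ã`
  set D0 : Matrix (Fin k) (Fin k) ℝ :=
    Matrix.of fun i j => fderiv ℝ (fun q => S.symA0 Sym (û q) i j) p (1, 0) with hD0
  set D : Fin d → Matrix (Fin k) (Fin k) ℝ := fun l =>
    Matrix.of fun i j => fderiv ℝ (fun q => S.symA Sym l (û q) i j) p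
      (0, EuclideanSpace.single l 1) with hD
  -- derivatives of `u`
  set Ut : Fin k → ℝ := fderiv ℝ û p (1, 0) with hUt
  set U : Fin d → Fin k → ℝ := fun l => fderiv ℝ û p (0, EuclideanSpace.single l 1) with hU
  -- the energy density derivative
  have hE : fderiv ℝ (S.energyDensity Sym ubar û) p (1, 0) =
      2 * (w ⬝ᵥ (S.symA0 Sym (u t x) *ᵥ Ut)) + w ⬝ᵥ (D0 *ᵥ w) := by
    have hfun : S.energyDensity Sym ubar û =
        fun q => (û q - ubar) ⬝ᵥ (S.symA0 Sym (û q) *ᵥ (û q - ubar)) := rfl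
    rw [hfun, fderiv_dotProduct_mulVec_apply hdiffw hA0d, hfdw, hup]
    rw [dotProduct_mulVec_comm_of_transpose (hsymm0 _ hK) Ut w]
    ring
  -- the flux derivatives
  have hF : ∀ l, fderiv ℝ (S.energyFlux Sym ubar û l) p (0, EuclideanSpace.single l 1) =
      2 * (w ⬝ᵥ (S.symA Sym l (u t x) *ᵥ U l)) + w ⬝ᵥ (D l *ᵥ w) := by
    intro l
    have hfun : S.energyFlux Sym ubar û l =
        fun q => (û q - ubar) ⬝ᵥ (S.symA Sym l (û q) *ᵥ (û q - ubar)) := rfl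
    rw [hfun, fderiv_dotProduct_mulVec_apply hdiffw (hAd l), hfdw, hup]
    rw [dotProduct_mulVec_comm_of_transpose (hsymm _ hK l) (U l) w]
    ring
  -- the equation
  have hPDE : w ⬝ᵥ (S.symA0 Sym (u t x) *ᵥ Ut) + ∑ l, w ⬝ᵥ (S.symA Sym l (u t x) *ᵥ U l) =
      -(w ⬝ᵥ (Sym (u t x) *ᵥ S.B (u t x))) := hu.dotProduct_sym_eqn Sym w ht x
  -- the bounds
  have hnw : ‖w‖ ^ 2 = ‖w‖ * ‖w‖ := pow_two _
  have hP : |w ⬝ᵥ (Sym (u t x) *ᵥ S.B (u t x))| ≤ k * L * ‖w‖ ^ 2 := by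
    calc |w ⬝ᵥ (Sym (u t x) *ᵥ S.B (u t x))| ≤ k * (‖w‖ * ‖Sym (u t x) *ᵥ S.B (u t x)‖) :=
          abs_dotProduct_le _ _
      _ ≤ k * (‖w‖ * (L * ‖u t x - ubar‖)) := by
          gcongr
          exact hL _ hK
      _ = k * L * ‖w‖ ^ 2 := by rw [hw]; ring
  have hv1 : ‖((1 : ℝ), (0 : Space d))‖ ≤ 1 := by simp [Prod.norm_def]
  have hv2 : ∀ l : Fin d, ‖((0 : ℝ), EuclideanSpace.single l (1 : ℝ))‖ ≤ 1 := fun l => by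
    simp [Prod.norm_def]
  have hentry0 : ∀ i j, |D0 i j| ≤ Ĉ := fun i j => by
    simp only [hD0, Matrix.of_apply]
    rw [← Real.norm_eq_abs]
    simpa using (fderiv ℝ (fun q => S.symA0 Sym (û q) i j) p).le_of_opNorm_le_of_le
      (hĈ0 i j) hv1
  have hentry : ∀ l i j, |D l i j| ≤ Ĉ := fun l i j => by
    simp only [hD, Matrix.of_apply]
    rw [← Real.norm_eq_abs]
    simpa using (fderiv ℝ (fun q => S.symA Sym l (û q) i j) p).le_of_opNorm_le_of_le
      (hĈ l i j) (hv2 l)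
  have hsum_entries : ∀ {Mx : Matrix (Fin k) (Fin k) ℝ}, (∀ i j, |Mx i j| ≤ Ĉ) →
      (∑ i, ∑ j, |Mx i j|) ≤ k ^ 2 * Ĉ := fun h => by
    calc (∑ i, ∑ j, |_|) ≤ ∑ _i : Fin k, ∑ _j : Fin k, Ĉ :=
          Finset.sum_le_sum fun i _ => Finset.sum_le_sum fun j _ => h i j
      _ = k ^ 2 * Ĉ := by simp; ring
  have hR0 : |w ⬝ᵥ (D0 *ᵥ w)| ≤ k ^ 2 * Ĉ * ‖w‖ ^ 2 := by
    calc |w ⬝ᵥ (D0 *ᵥ w)| ≤ (∑ i, ∑ j, |D0 i j|) * (‖w‖ * ‖w‖) := abs_dotProduct_mulVec_le _ _ _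
      _ ≤ k ^ 2 * Ĉ * (‖w‖ * ‖w‖) :=
          mul_le_mul_of_nonneg_right (hsum_entries hentry0) (mul_nonneg (norm_nonneg _)
            (norm_nonneg _))
      _ = k ^ 2 * Ĉ * ‖w‖ ^ 2 := by rw [hnw]
  have hR : ∀ l, |w ⬝ᵥ (D l *ᵥ w)| ≤ k ^ 2 * Ĉ * ‖w‖ ^ 2 := fun l => by
    calc |w ⬝ᵥ (D l *ᵥ w)| ≤ (∑ i, ∑ j, |D l i j|) * (‖w‖ * ‖w‖) := abs_dotProduct_mulVec_le _ _ _
      _ ≤ k ^ 2 * Ĉ * (‖w‖ * ‖w‖) :=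
          mul_le_mul_of_nonneg_right (hsum_entries (hentry l)) (mul_nonneg (norm_nonneg _)
            (norm_nonneg _))
      _ = k ^ 2 * Ĉ * ‖w‖ ^ 2 := by rw [hnw]
  have hRsum : ∑ l, w ⬝ᵥ (D l *ᵥ w) ≤ d * (k ^ 2 * Ĉ * ‖w‖ ^ 2) := by
    calc ∑ l, w ⬝ᵥ (D l *ᵥ w) ≤ ∑ _l : Fin d, k ^ 2 * Ĉ * ‖w‖ ^ 2 :=
          Finset.sum_le_sum fun l _ => (le_abs_self _).trans (hR l)
      _ = d * (k ^ 2 * Ĉ * ‖w‖ ^ 2) := by simp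
  -- assemble
  have hid : fderiv ℝ (S.energyDensity Sym ubar û) p (1, 0) +
      ∑ l, fderiv ℝ (S.energyFlux Sym ubar û l) p (0, EuclideanSpace.single l 1) =
      -2 * (w ⬝ᵥ (Sym (u t x) *ᵥ S.B (u t x))) + (w ⬝ᵥ (D0 *ᵥ w) + ∑ l, w ⬝ᵥ (D l *ᵥ w)) := by
    rw [hE]
    simp_rw [hF]
    rw [Finset.sum_add_distrib, ← Finset.mul_sum]
    linear_combination 2 * hPDE
  rw [hid]
  have h1 := (abs_le.1 hP).1
  have h2 := le_abs_self (w ⬝ᵥ (D0 *ᵥ w))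
  nlinarith [h1, h2, hR0, hRsum, sq_nonneg ‖w‖]

/-- **The cone (space-like) condition for the fluxes** [Racke2015, (3.11)]: if
`|⟨ξ, Ãⱼ(v)ξ⟩| ≤ α‖ξ‖²` on `K₀` then `|Σⱼ νⱼ fⱼ| ≤ dα‖u - ū‖²` for `‖ν‖ ≤ 1` wherever
`u(t, x) ∈ K₀`. [cite: Racke2015, Ch. 3 Thm 3.1] -/
theorem energyFlux_cone_bound {α : ℝ}
    (hα : ∀ l, ∀ v ∈ K₀, ∀ ξ : Fin k → ℝ, |ξ ⬝ᵥ (S.symA Sym l v *ᵥ ξ)| ≤ α * ‖ξ‖ ^ 2)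
    {û : ℝ × Space d → Fin k → ℝ} {p : ℝ × Space d} (hp : û p ∈ K₀) (ν : Space d)
    (hν : ‖ν‖ ≤ 1) :
    |∑ j, ν j * S.energyFlux Sym ubar û j p| ≤ d * α * ‖û p - ubar‖ ^ 2 := by
  have hνj : ∀ j, |ν j| ≤ 1 := fun j =>
    ((Real.norm_eq_abs _).symm.le.trans (PiLp.norm_apply_le ν j)).trans hν
  calc |∑ j, ν j * S.energyFlux Sym ubar û j p|
      ≤ ∑ j, |ν j * S.energyFlux Sym ubar û j p| := Finset.abs_sum_le_sum_abs _ _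
    _ ≤ ∑ _j : Fin d, α * ‖û p - ubar‖ ^ 2 := Finset.sum_le_sum fun j _ => by
        rw [abs_mul]
        calc |ν j| * |S.energyFlux Sym ubar û j p| ≤ 1 * (α * ‖û p - ubar‖ ^ 2) :=
              mul_le_mul (hνj j) (hα j _ hp _) (abs_nonneg _) zero_le_one
          _ = α * ‖û p - ubar‖ ^ 2 := one_mul _
    _ = d * α * ‖û p - ubar‖ ^ 2 := by simp; ring

/-- **Coercivity of the energy density**: `λ‖u - ū‖² ≤ e` wherever `u(t, x) ∈ K₀`.
[cite: Racke2015, Ch. 3 Thm 3.1] -/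
theorem mul_norm_sq_le_energyDensity {lam : ℝ}
    (hlam : ∀ v ∈ K₀, ∀ ξ : Fin k → ℝ, lam * ‖ξ‖ ^ 2 ≤ ξ ⬝ᵥ (S.symA0 Sym v *ᵥ ξ))
    {û : ℝ × Space d → Fin k → ℝ} {p : ℝ × Space d} (hp : û p ∈ K₀) :
    lam * ‖û p - ubar‖ ^ 2 ≤ S.energyDensity Sym ubar û p :=
  hlam _ hp _

end Bulk

end QuasilinearSystem

end Literature.Barriers.AtomisticToContinuum

end
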